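import Summits.ValiantsHypothesis.ValiantsHypothesis.Theorems.BarrierLeverChowBenchmarkPairsBlockPeelCoverTriple
import Summits.ValiantsHypothesis.ValiantsHypothesis.Theorems.BarrierLeverChowBenchmarkPairsBlockPeelCertKit

/-!
# Route BarrierLever — item 22038 `ChowBenchmarkPairs`, line `moore-peel`: the BLOCK PEEL, VIII-a — the CONFLUENT TRIPLE
# CRITERION, part 1: the confluent matrix `C^κ(i)`, the row operations, and the attached-row coefficients

Helper file (`--supports stmt-ValiantsHypothesis-22038`; cell valiant-natproofs, rung V4, 𝒟-side benchmark of record, line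
`moore_peel`, planner RULING R58(c) «then attack it»; seat val-np-p4 gen 31).  Closes NO item.

THE IDEA (memo HOME/val-np-p4/g31/memo/MEMO-valnp4-g31.md §2).  Let the three tied points of a triple block MERGE: ratios
`Λ = (1, 1+X, 1+2X)`, `X → 0`.  Row operations inside each label class `{(0,q),(1,q),(2,q)}` (second differences) and inside
the three internal pair rows make every row divisible by `X^m`, `m = 0, 1, 2`, with `X^m`-coefficients the INTEGER matrix

  `C^κ(i)`:  rows `κ̃[q,B]`, `κ̃[q,B]·B`, `κ̃[q,B]·B²` (`q < i`, `κ̃[q,B] = [T_q ⊆ T_B]·κ(|B|-|q|)`, `B` the column CODE read as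
  an integer) and three pair rows `Σ_{d⊆T_B} κ|B∖d|κ|d|`, `Σ_d κ|B∖d|κ|d|·d`, `Σ_d κ|B∖d|κ|d|·(C(B-d,2) + 2(B-d)d - 3C(d,2))`,
  columns the triple window `[c_i, c_{i+3})`

(`confMatrix`).  THIS FILE: the definitions (`confPoint`, `confMatrix`, the class members `confMem`, the row-operation
coefficients `confCoef`, the reduced rows `confRed`), the evaluation of the reduced rows class by class, and the coefficients of
the attached factors `attFac1`, `attFac2` (`coeff_0 = coeff_1 = 0`, `coeff_2 = B²`).  The companion file `…BlockPeelConfluent`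
finishes: pair-row coefficients, the factorisation `U · J(Λ_conf) = diag(X^{pos}) · Q`, **`det_blockMatrix_three_X_ne_zero_of_confluent`**
(`det C^κ(i) ≠ 0 ⇒ det J^κ(i,3)(Λ) ≠ 0`) and the node **`Stmt.conjConfluentNearBad`** with its arrow to `Stmt.conjB3` / node #1.

EVIDENCE (kit j333048 / j333081 / j333183, `--workitem 22038`, ranks mod 65521): `C^{!}(i)` is nonsingular at EVERY triple
`{i,i+1,i+2}` touching a bad stage `b ≤ 3000` of THEOREM W (31 bad stages, 84 triples) — including the covering triples
`{444,445,446}`, `{726,727,728}`, `{892,893,894}`, `{1788,…}`, `{2897,…}`, `{2986,…}`, `{2997,…}` of the singular bad-start doubles and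
the triples through `183, 364, 725` where the analogous confluent DOUBLE matrix `[κ̃; κ̃·B; (|B|+1)!]` is singular (deficiencies
10, 16, 30); in the exhaustive scan `i ≤ 1000` the triple matrix is singular ONLY at the two all-good triples `i = 384, 746` (where
three good singles certify the block anyway) — hence the node below is restricted to triples touching a bad stage.  Its left null
vectors would be tuples of quadratic polynomials `P_q(B)` with `Σ_q P_q(B) κ̃[q,B]` in the span of the three pair rows on the `3i+3`
consecutive codes `[c_i, c_{i+3})`: a λ-free statement, polynomial in the code.

WHAT THIS IS NOT: `Stmt.conjConfluentB3`, `Stmt.conjB3` and node #1 stay OPEN; nothing on crux stmt-ValiantsHypothesis-14610 or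
on `VP` versus `VNP`.
-/

set_option linter.dupNamespace false

namespace Summit.ValiantsHypothesis.ValiantsHypothesis.Theorems.BarrierLever.MoorePeel

open Polynomial Finset

/-! ## 23. The confluent point and binomial coefficients of `(1 + kX)^n` -/

/-- The confluent specialisation of the three ratios: `Λ_s = 1 + s·X`. -/
noncomputable def confPoint : Fin 3 → ℤ[X] := fun s => 1 + C ((s : ℕ) : ℤ) * X

/-- `coeff_j (1 + kX)^n = k^j · C(n,j)`. -/
theorem coeff_one_add_C_mul_X_pow (k : ℤ) (n j : ℕ) :
    ((1 + C k * X : ℤ[X]) ^ n).coeff j = k ^ j * (n.choose j : ℤ) := by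
  rw [add_comm, add_pow]
  rw [finsetSum_coeff]
  simp_rw [one_pow, mul_one, mul_pow, ← C_pow]
  have h : ∀ m ∈ Finset.range (n + 1), ((C (k ^ m) * X ^ m * (n.choose m : ℤ[X])).coeff j) =
      if j = m then k ^ j * (n.choose j : ℤ) else 0 := by
    intro m _
    rw [← C_eq_natCast, mul_comm, ← mul_assoc, ← C_mul, coeff_C_mul_X_pow]
    split_ifs with h
    · subst h; ring
    · rfl
  rw [Finset.sum_congr rfl h, Finset.sum_ite_eq]
  split_ifs with hj
  · rfl
  · rw [Finset.mem_range, not_lt] at hj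
    rw [Nat.choose_eq_zero_of_lt (by omega), Nat.cast_zero, mul_zero]

/-- The confluent point at `s`: `(1 + sX)^n` has `coeff_j = s^j C(n,j)`. -/
theorem coeff_confPoint_pow (s : Fin 3) (n j : ℕ) :
    ((confPoint s) ^ n).coeff j = ((s : ℕ) : ℤ) ^ j * (n.choose j : ℤ) :=
  coeff_one_add_C_mul_X_pow _ n j

/-- `2·C(n,2) = n(n-1)` over `ℤ` (with `n - 1` read in `ℤ`). -/
theorem two_mul_choose_two_int (n : ℕ) : (2 : ℤ) * (n.choose 2 : ℤ) = (n : ℤ) * ((n : ℤ) - 1) := by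
  rcases Nat.eq_zero_or_pos n with rfl | hn
  · simp
  · obtain ⟨m, rfl⟩ : ∃ m, n = m + 1 := ⟨n - 1, by omega⟩
    rw [Nat.choose_two_right]
    have he : (m + 1) * m / 2 * 2 = (m + 1) * m :=
      Nat.div_mul_cancel (by
        rcases Nat.even_or_odd m with h | h
        · exact (Nat.even_mul.mpr (Or.inr h)).two_dvd
        · exact (Nat.even_mul.mpr (Or.inl (by rcases h with ⟨k, hk⟩; exact ⟨k + 1, by omega⟩))).two_dvd)
    have : ((m + 1) * (m + 1 - 1) / 2 : ℕ) * 2 = (m + 1) * m := by simpa using he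
    push_cast
    have hc : (((m + 1) * (m + 1 - 1) / 2 : ℕ) : ℤ) * 2 = ((m : ℤ) + 1) * m := by exact_mod_cast this
    linarith

/-! ## 24. The confluent matrix `C^κ(i)` -/

/-- Pair row 0: `Σ_{d ⊆ T_B} κ|B∖d|·κ|d|` (`= pairCoef κ 1 1 B`). -/
def confPair0 (κ : ℕ → ℕ) (B : ℕ) : ℤ :=
  ∑ d ∈ (bits B).powerset, ((κ (bits B \ d).card : ℕ) : ℤ) * ((κ d.card : ℕ) : ℤ)

/-- Pair row 1: `Σ_{d ⊆ T_B} κ|B∖d|·κ|d|·bin d`. -/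
def confPair1 (κ : ℕ → ℕ) (B : ℕ) : ℤ :=
  ∑ d ∈ (bits B).powerset, ((κ (bits B \ d).card : ℕ) : ℤ) * ((κ d.card : ℕ) : ℤ) * (bin d : ℤ)

/-- Pair row 2: `Σ_{d ⊆ T_B} κ|B∖d|·κ|d|·(C(bin(B∖d),2) + 2·bin(B∖d)·bin d - 3·C(bin d,2))`. -/
def confPair2 (κ : ℕ → ℕ) (B : ℕ) : ℤ :=
  ∑ d ∈ (bits B).powerset, ((κ (bits B \ d).card : ℕ) : ℤ) * ((κ d.card : ℕ) : ℤ) *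
    (((bin (bits B \ d)).choose 2 : ℤ) + 2 * (bin (bits B \ d) : ℤ) * (bin d : ℤ) - 3 * ((bin d).choose 2 : ℤ))

/-- The position of a block row inside its class: `s` for an attached row `(s, q)`, `q < i`; `0, 1, 2` for the pair rows
`(1,i), (2,i), (2,i+1)`. -/
def confPos (i : ℕ) (ρ : BlockIdx i 3) : ℕ := if (ρ.2 : ℕ) < i then (ρ.1 : ℕ) else (ρ.1 : ℕ) + (ρ.2 : ℕ) - i - 1

/-- **The entries of the confluent matrix** at column code `B`. -/
def confEntry (κ : ℕ → ℕ) (i : ℕ) (ρ : BlockIdx i 3) (B : ℕ) : ℤ :=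
  if (ρ.2 : ℕ) < i then ((kincl κ (ρ.2 : ℕ) B : ℕ) : ℤ) * (B : ℤ) ^ (ρ.1 : ℕ)
  else if confPos i ρ = 0 then confPair0 κ B else if confPos i ρ = 1 then confPair1 κ B else confPair2 κ B

/-- **The confluent matrix `C^κ(i)`** of the triple block: block rows × the triple window `[c_i, c_{i+3})`. -/
def confMatrix (κ : ℕ → ℕ) (i : ℕ) : Matrix (BlockIdx i 3) (BlockIdx i 3) ℤ :=
  Matrix.of fun ρ ρ' => confEntry κ i ρ (windowStart i + (finSigmaFinEquiv ρ' : ℕ))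

/-! ## 25. The row operations -/

/-- The three internal pair rows `(1,i)` (`p01`), `(2,i)` (`p02`), `(2,i+1)` (`p12`). -/
def confPairMem (i : ℕ) : Fin 3 → BlockIdx i 3 :=
  ![⟨1, ⟨i, by simp⟩⟩, ⟨2, ⟨i, by simp⟩⟩, ⟨2, ⟨i + 1, by simp⟩⟩]

/-- The members of the class of a block row: the attached class `{(0,q),(1,q),(2,q)}` of `q < i`, or the pair class. -/
def confMem (i : ℕ) (k : Fin 3) (ρ : BlockIdx i 3) : BlockIdx i 3 :=
  if h : (ρ.2 : ℕ) < i then ⟨k, ⟨ρ.2, by have := k.2; omega⟩⟩ else confPairMem i k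

/-- The coefficients of the row operation (attached class with label `q`: second differences corrected by lower rows;
pair class: `p01`, `p02 - p01`, `p12 - 2 p02 + p01`). -/
noncomputable def confCoef (i : ℕ) (ρ : BlockIdx i 3) : Fin 3 → ℤ[X] :=
  if (ρ.2 : ℕ) < i then
    (if confPos i ρ = 0 then ![1, 0, 0]
     else if confPos i ρ = 1 then ![-1 + C ((ρ.2 : ℕ) : ℤ) * X, 1, 0]
     else ![1 - C ((2 * (ρ.2 : ℕ) + 1 : ℕ) : ℤ) * X + C (((ρ.2 : ℕ) ^ 2 : ℕ) : ℤ) * X ^ 2,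
            -2 + C ((2 * (ρ.2 : ℕ) + 1 : ℕ) : ℤ) * X, 1])
  else
    (if confPos i ρ = 0 then ![1, 0, 0] else if confPos i ρ = 1 then ![-1, 1, 0] else ![1, -2, 1])

/-- The block matrix at the confluent point, as a function of the column code. -/
noncomputable def confJ (κ : ℕ → ℕ) (i : ℕ) (ρ : BlockIdx i 3) (B : ℕ) : ℤ[X] := blockEntry κ i confPoint ρ B

/-- **The reduced rows**: `Σ_k confCoef ρ k · J(confMem k ρ)`. -/
noncomputable def confRed (κ : ℕ → ℕ) (i : ℕ) (ρ : BlockIdx i 3) (B : ℕ) : ℤ[X] :=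
  ∑ k : Fin 3, confCoef i ρ k * confJ κ i (confMem i k ρ) B

/-! ## 26. The block matrix at the confluent point, class by class -/

/-- `Λ_0 = 1` at the confluent point. -/
theorem confPoint_zero : confPoint 0 = 1 := by simp [confPoint]

/-- `Λ_s = 1` whenever `s` has value `0`. -/
theorem confPoint_of_val_eq_zero (s : Fin 3) (h : (s : ℕ) = 0) : confPoint s = 1 := by
  simp [confPoint, h]

/-- `confPos ≤ 2`. -/
theorem confPos_le_two (i : ℕ) (ρ : BlockIdx i 3) : confPos i ρ ≤ 2 := by
  unfold confPos
  have h1 := ρ.1.2; have h2 := ρ.2.2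
  split_ifs <;> omega

/-- For an attached row, `confPos = s`. -/
theorem confPos_of_lt (i : ℕ) (ρ : BlockIdx i 3) (hq : (ρ.2 : ℕ) < i) : confPos i ρ = (ρ.1 : ℕ) := by
  unfold confPos; rw [if_pos hq]

/-- Attached members evaluate to `κ̃[q,B] · (1 + kX)^{B-q}`. -/
theorem confJ_confMem_of_lt (κ : ℕ → ℕ) (i : ℕ) (ρ : BlockIdx i 3) (hq : (ρ.2 : ℕ) < i) (k : Fin 3) (B : ℕ) :
    confJ κ i (confMem i k ρ) B = ((kincl κ (ρ.2 : ℕ) B : ℕ) : ℤ[X]) * (confPoint k) ^ (B - (ρ.2 : ℕ)) := by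
  unfold confJ confMem
  rw [dif_pos hq]
  unfold blockEntry
  simp only
  rw [if_pos hq]

/-- Unfolding `confPoint` at an anonymous-constructor index. -/
theorem confPoint_mk (v : ℕ) (h : v < 3) : confPoint ⟨v, h⟩ = 1 + C (v : ℤ) * X := rfl

/-- Pair member `0` is `p01 = pairCoef κ 1 Λ_1`. -/
theorem confJ_confMem_pair0 (κ : ℕ → ℕ) (i : ℕ) (ρ : BlockIdx i 3) (hq : ¬ (ρ.2 : ℕ) < i) (B : ℕ) :
    confJ κ i (confMem i 0 ρ) B = pairCoef κ 1 (confPoint 1) B := by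
  unfold confJ confMem
  rw [dif_neg hq]
  simp only [confPairMem, Matrix.cons_val_zero]
  rw [blockEntry, if_neg (by simp)]
  congr 1
  rw [confPoint_mk]
  simp

/-- Pair member `1` is `p02 = pairCoef κ 1 Λ_2`. -/
theorem confJ_confMem_pair1 (κ : ℕ → ℕ) (i : ℕ) (ρ : BlockIdx i 3) (hq : ¬ (ρ.2 : ℕ) < i) (B : ℕ) :
    confJ κ i (confMem i 1 ρ) B = pairCoef κ 1 (confPoint 2) B := by
  unfold confJ confMem
  rw [dif_neg hq]
  simp only [confPairMem, Matrix.cons_val_one, Matrix.cons_val_zero]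
  rw [blockEntry, if_neg (by simp)]
  congr 1
  rw [confPoint_mk]
  simp

/-- Pair member `2` is `p12 = pairCoef κ Λ_1 Λ_2`. -/
theorem confJ_confMem_pair2 (κ : ℕ → ℕ) (i : ℕ) (ρ : BlockIdx i 3) (hq : ¬ (ρ.2 : ℕ) < i) (B : ℕ) :
    confJ κ i (confMem i 2 ρ) B = pairCoef κ (confPoint 1) (confPoint 2) B := by
  unfold confJ confMem
  rw [dif_neg hq]
  simp only [confPairMem, Matrix.cons_val_two, Matrix.tail_cons, Matrix.head_cons]
  rw [blockEntry, if_neg (by simp)]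
  congr 1
  rw [confPoint_mk]
  simp [confPoint]

/-! ## 27. The reduced rows, class by class -/

section Reduced

variable (κ : ℕ → ℕ) (i : ℕ) (ρ : BlockIdx i 3) (B : ℕ)

/-- Attached class, position `0`: the constant row `κ̃[q,B]`. -/
theorem confRed_att0 (hq : (ρ.2 : ℕ) < i) (hs : confPos i ρ = 0) :
    confRed κ i ρ B = ((kincl κ (ρ.2 : ℕ) B : ℕ) : ℤ[X]) := by
  have hs' : (ρ.1 : ℕ) = 0 := by rw [← confPos_of_lt i ρ hq, hs]
  unfold confRed confCoef
  rw [if_pos hq, if_pos hs, Fin.sum_univ_three]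
  simp only [Matrix.cons_val_zero, Matrix.cons_val_one, Matrix.head_cons, Matrix.cons_val_two, Matrix.tail_cons,
    zero_mul, add_zero, one_mul, confJ_confMem_of_lt κ i ρ hq]
  rw [confPoint_of_val_eq_zero 0 rfl, one_pow, mul_one]

/-- Attached class, position `1`: `κ̃ · ((1+X)^{B-q} - 1 + qX)`. -/
theorem confRed_att1 (hq : (ρ.2 : ℕ) < i) (hs : confPos i ρ = 1) :
    confRed κ i ρ B = ((kincl κ (ρ.2 : ℕ) B : ℕ) : ℤ[X]) *
      ((confPoint 1) ^ (B - (ρ.2 : ℕ)) - 1 + C ((ρ.2 : ℕ) : ℤ) * X) := by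
  unfold confRed confCoef
  rw [if_pos hq, if_neg (by rw [hs]; norm_num), if_pos hs, Fin.sum_univ_three]
  simp only [Matrix.cons_val_zero, Matrix.cons_val_one, Matrix.head_cons, Matrix.cons_val_two, Matrix.tail_cons,
    zero_mul, add_zero, one_mul, confJ_confMem_of_lt κ i ρ hq]
  rw [confPoint_of_val_eq_zero 0 rfl, one_pow, mul_one]
  ring

/-- Attached class, position `2`: `κ̃ · ((1+2X)^n + (-2 + (2q+1)X)(1+X)^n + (1 - (2q+1)X + q²X²))`, `n = B - q`. -/
theorem confRed_att2 (hq : (ρ.2 : ℕ) < i) (hs0 : confPos i ρ ≠ 0) (hs1 : confPos i ρ ≠ 1) :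
    confRed κ i ρ B = ((kincl κ (ρ.2 : ℕ) B : ℕ) : ℤ[X]) *
      ((confPoint 2) ^ (B - (ρ.2 : ℕ)) + (-2 + C ((2 * (ρ.2 : ℕ) + 1 : ℕ) : ℤ) * X) * (confPoint 1) ^ (B - (ρ.2 : ℕ)) +
        (1 - C ((2 * (ρ.2 : ℕ) + 1 : ℕ) : ℤ) * X + C (((ρ.2 : ℕ) ^ 2 : ℕ) : ℤ) * X ^ 2)) := by
  unfold confRed confCoef
  rw [if_pos hq, if_neg hs0, if_neg hs1, Fin.sum_univ_three]
  simp only [Matrix.cons_val_zero, Matrix.cons_val_one, Matrix.head_cons, Matrix.cons_val_two, Matrix.tail_cons,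
    one_mul, confJ_confMem_of_lt κ i ρ hq]
  rw [confPoint_of_val_eq_zero 0 rfl, one_pow, mul_one]
  ring

/-- Pair class, position `0`: `p01`. -/
theorem confRed_pair0 (hq : ¬ (ρ.2 : ℕ) < i) (hs : confPos i ρ = 0) :
    confRed κ i ρ B = pairCoef κ 1 (confPoint 1) B := by
  unfold confRed confCoef
  rw [if_neg hq, if_pos hs, Fin.sum_univ_three]
  simp only [Matrix.cons_val_zero, Matrix.cons_val_one, Matrix.head_cons, Matrix.cons_val_two, Matrix.tail_cons,
    zero_mul, add_zero, one_mul, confJ_confMem_pair0 κ i ρ hq]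

/-- Pair class, position `1`: `p02 - p01`. -/
theorem confRed_pair1 (hq : ¬ (ρ.2 : ℕ) < i) (hs : confPos i ρ = 1) :
    confRed κ i ρ B = pairCoef κ 1 (confPoint 2) B - pairCoef κ 1 (confPoint 1) B := by
  unfold confRed confCoef
  rw [if_neg hq, if_neg (by rw [hs]; norm_num), if_pos hs, Fin.sum_univ_three]
  simp only [Matrix.cons_val_zero, Matrix.cons_val_one, Matrix.head_cons, Matrix.cons_val_two, Matrix.tail_cons,
    zero_mul, add_zero, one_mul, neg_mul, confJ_confMem_pair0 κ i ρ hq, confJ_confMem_pair1 κ i ρ hq]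
  ring

/-- Pair class, position `2`: `p01 - 2 p02 + p12`. -/
theorem confRed_pair2 (hq : ¬ (ρ.2 : ℕ) < i) (hs0 : confPos i ρ ≠ 0) (hs1 : confPos i ρ ≠ 1) :
    confRed κ i ρ B = pairCoef κ 1 (confPoint 1) B - 2 * pairCoef κ 1 (confPoint 2) B +
      pairCoef κ (confPoint 1) (confPoint 2) B := by
  unfold confRed confCoef
  rw [if_neg hq, if_neg hs0, if_neg hs1, Fin.sum_univ_three]
  simp only [Matrix.cons_val_zero, Matrix.cons_val_one, Matrix.head_cons, Matrix.cons_val_two, Matrix.tail_cons,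
    one_mul, neg_mul, confJ_confMem_pair0 κ i ρ hq, confJ_confMem_pair1 κ i ρ hq, confJ_confMem_pair2 κ i ρ hq]
  ring

end Reduced

/-! ## 28. Coefficients of the reduced rows -/

section Coeff

/-- `coeff_1` of a product. -/
theorem coeff_mul_one' (p q : ℤ[X]) : (p * q).coeff 1 = p.coeff 0 * q.coeff 1 + p.coeff 1 * q.coeff 0 := by
  rw [coeff_mul, Finset.Nat.sum_antidiagonal_succ, Finset.Nat.antidiagonal_zero, Finset.sum_singleton]

/-- `coeff_2` of a product. -/
theorem coeff_mul_two' (p q : ℤ[X]) :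
    (p * q).coeff 2 = p.coeff 0 * q.coeff 2 + p.coeff 1 * q.coeff 1 + p.coeff 2 * q.coeff 0 := by
  rw [coeff_mul, Finset.Nat.sum_antidiagonal_succ, Finset.Nat.sum_antidiagonal_succ, Finset.Nat.antidiagonal_zero,
    Finset.sum_singleton]
  ring

/-- The low coefficients of the confluent point powers. -/
theorem coeff_confPoint_pow_zero (s : Fin 3) (n : ℕ) : ((confPoint s) ^ n).coeff 0 = 1 := by
  rw [coeff_confPoint_pow]; simp

/-- `coeff_1 (1 + sX)^n = s·n`. -/
theorem coeff_confPoint_pow_one (s : Fin 3) (n : ℕ) : ((confPoint s) ^ n).coeff 1 = ((s : ℕ) : ℤ) * n := by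
  rw [coeff_confPoint_pow]; simp

/-- `coeff_2 (1 + sX)^n = s²·C(n,2)`. -/
theorem coeff_confPoint_pow_two (s : Fin 3) (n : ℕ) :
    ((confPoint s) ^ n).coeff 2 = ((s : ℕ) : ℤ) ^ 2 * (n.choose 2 : ℤ) := by
  rw [coeff_confPoint_pow]

/-- A natural-number scalar in front of a polynomial: `coeff_j (↑a · p) = a · coeff_j p`. -/
theorem coeff_natCast_mul' (a : ℕ) (p : ℤ[X]) (j : ℕ) : (((a : ℕ) : ℤ[X]) * p).coeff j = (a : ℤ) * p.coeff j := by
  rw [← map_natCast C a, coeff_C_mul]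

/-- The attached factor at position `1`: `(1+X)^n - 1 + qX`. -/
noncomputable def attFac1 (q n : ℕ) : ℤ[X] := (confPoint 1) ^ n - 1 + C ((q : ℕ) : ℤ) * X

/-- The attached factor at position `2`: `(1+2X)^n + (-2 + (2q+1)X)(1+X)^n + (1 - (2q+1)X + q²X²)`. -/
noncomputable def attFac2 (q n : ℕ) : ℤ[X] :=
  (confPoint 2) ^ n + (C (-2 : ℤ) + C ((2 * q + 1 : ℕ) : ℤ) * X) * (confPoint 1) ^ n +
    (1 - C ((2 * q + 1 : ℕ) : ℤ) * X + C ((q ^ 2 : ℕ) : ℤ) * X ^ 2)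

/-- `attFac1` has no constant term. -/
theorem coeff_attFac1_zero (q n : ℕ) : (attFac1 q n).coeff 0 = 0 := by
  unfold attFac1
  rw [coeff_add, coeff_sub, coeff_confPoint_pow_zero, coeff_one_zero, coeff_C_mul_X]
  simp

/-- The linear coefficient of `attFac1 q n` is `n + q`. -/
theorem coeff_attFac1_one (q n : ℕ) : (attFac1 q n).coeff 1 = (n : ℤ) + q := by
  unfold attFac1
  rw [coeff_add, coeff_sub, coeff_confPoint_pow_one, coeff_one, coeff_C_mul_X]
  simp

/-- `attFac2` has no constant term. -/
theorem coeff_attFac2_zero (q n : ℕ) : (attFac2 q n).coeff 0 = 0 := by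
  unfold attFac2
  rw [coeff_add, coeff_add, coeff_confPoint_pow_zero, coeff_mul, Finset.Nat.antidiagonal_zero, Finset.sum_singleton]
  simp only [coeff_confPoint_pow_zero, coeff_add, coeff_sub, coeff_C, coeff_C_mul_X, coeff_one_zero,
    coeff_C_mul_X_pow]
  norm_num

/-- `attFac2` has no linear term. -/
theorem coeff_attFac2_one (q n : ℕ) : (attFac2 q n).coeff 1 = 0 := by
  unfold attFac2
  rw [coeff_add, coeff_add, coeff_mul_one']
  simp only [coeff_confPoint_pow_zero, coeff_confPoint_pow_one, coeff_add, coeff_sub, coeff_C, coeff_C_mul_X,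
    coeff_one, coeff_C_mul_X_pow, Fin.val_one, Fin.val_two]
  push_cast
  ring

/-- The quadratic coefficient of `attFac2 q n` is `(n + q)²`. -/
theorem coeff_attFac2_two (q n : ℕ) : (attFac2 q n).coeff 2 = ((n : ℤ) + q) ^ 2 := by
  unfold attFac2
  rw [coeff_add, coeff_add, coeff_mul_two']
  simp only [coeff_confPoint_pow_zero, coeff_confPoint_pow_one, coeff_confPoint_pow_two, coeff_add, coeff_sub,
    coeff_C, coeff_C_mul_X, coeff_one, coeff_C_mul_X_pow, Fin.val_one, Fin.val_two]
  have h2 := two_mul_choose_two_int n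
  push_cast
  linear_combination h2

end Coeff

end Summit.ValiantsHypothesis.ValiantsHypothesis.Theorems.BarrierLever.MoorePeel
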